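import Summits.BirchSwinnertonDyer.BirchSwinnertonDyer.Theorems.CyclotomicUntwistC1OfPrintByName
import Literature.NumberTheory.EllipticCurves.CuspFormLFunctionLevelConductorProofs
import Literature.NumberTheory.EllipticCurves.ModularParametrizationBCDTProofs
import Literature.NumberTheory.EllipticCurves.GrossZagierRationalPointProofs
import HarnessLib

/-!
# Crux child C1 `PSUntwistedLFunctionAtThree` ⟸ FIVE named print facts, by name: Carayol's LEVEL theorem
# is not an input (it is a theorem of the tree granted modularity) — a CONDITIONAL result

Cell `pub/bsd-wall` (D-0145 line `route-BirchSwinnertonDyer-CyclotomicUntwist` rev 9), seat `bsd-line-cycu-p3`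
(prover seat 3/3, gen 11). THEOREMS ONLY (no definition, no new named fact, no `sorry`). BSD is not proved by this
file; crux child C1 = stmt-BirchSwinnertonDyer-27548 is NOT closed by it unconditionally: the closer below is
CONDITIONAL on five named print facts (Literature `def … : Prop` taken as hypotheses), and no crux of the route
(K1 21580 / K2 21581) is proved by it.

WHAT. The by-name closer of record `PSC1OfPrint.psUntwistedLFunctionAtThree_of_print` (lead cycu-p1 g8, p651954)
takes SIX named print facts: modularity `nonempty_modularParametrizationData`, Carayol's level theorem
`hlev : ∀ N, IsNewformOf.level_eq_conductorNorm (N := N)`, `GrossZagier1986_thm_I_7_3`, `PublishedInputGZK`,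
`Hida2000_thm326_exists_galoisRep`, `Carayol1986_eulerFactor`. The second is REDUNDANT given the first, by two
theorems already in the tree:

* `exists_isNewformOf_of_nonempty_modularParametrizationData` (`ModularParametrizationBCDTProofs`): the
  parametrisation datum gives a newform of `W` AT LEVEL `N_W` for every elliptic `W`;
* `IsNewformOf.level_eq_conductorNorm_of_exists_isNewformOf'` (`CuspFormLFunctionLevelConductorProofs`): a newform
  of `W` at level `N_W` pins the level of EVERY newform of `W` (strong multiplicity one across levels on `Γ₀`,
  Atkin–Lehner 1970 Thm. 4, the tree's `IsNewform0.level_eq_of_heckeEigenvalue_eq_holds`) — which is the named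
  fact `IsNewformOf.level_eq_conductorNorm` at every level.

Hence (this file):
* `level_eq_conductorNorm_of_modularity` — the `hlev` binder of the route's C1 files from `hmod` alone;
* `exists_periodRatio_of_modularity` — the period-ratio clause of EX′ (`ϖ·Ω_E = Ω⁺_f` for EVERY newform `f` of
  `W`, cycu-p2's `CyclotomicUntwistFiniteSlopeSeparatedPinnedExistence.exists_periodRatio`) from `hmod` alone;
* **`psUntwistedLFunctionAtThree_of_print5 : hmod → GZ86 → GZK → hDel → hCar → PSUntwistedLFunctionAtThree`** —
  C1 BY NAME from FIVE named print facts;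
* `stub_PRINT_C1_of_four` — the registered v7 stub `stub_PRINT_C1` of the K1/K2 skeletons `Lines/dfrob_wan.lean` /
  `Lines/dfrob_kato.lean` (the five-conjunct print packet, text verbatim) from FOUR named facts, so a v9 reshape may
  drop the Carayol-level conjunct;
* `psUntwistedLFunctionAtThree_of_primaryPrint` — the same closer with `GrossZagier1986_thm_I_7_3` replaced by its
  tree derivation `GrossZagier1986_thm_I_7_3_of_hoffsteinLuo` (`GrossZagierRationalPointProofs`: modularity +
  Hoffstein–Luo 1997 + the Gross–Zagier formula `gross_zagier` over the Heegner field), for pens who prefer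
  primary facts: C1 ⟸ {hmod, Hoffstein–Luo, `gross_zagier`, GZK, hDel, hCar}.

NET for the route: the print packet under K1/K2 modulo the research wall {C4 27546, C5≥ 27614 / C5≤ 27592} is
{`nonempty_modularParametrizationData`, `GrossZagier1986_thm_I_7_3`, `Hida2000_thm326_exists_galoisRep`,
`Carayol1986_eulerFactor`} ∪ {`PublishedInputGZK`} — four named facts plus the route's PUB item 19921.

References: [cite: AtkinLehner1970, Thm. 4] · [cite: DiamondShurman2005, Thm. 8.8.1] · [cite: BCDTJAMS2001, Thm. A]
· [cite: CarayolASENS1986, Thm. (A)] · [cite: Hida2000, Thm. 3.26 (1)] · [cite: GrossZagier1986, Thm. I.(7.3)] ·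
[cite: MazurTateTeitelbaum1986Invent, §I.14].
-/

noncomputable section

open scoped MatrixGroups NumberField

open CongruenceSubgroup Field
  Literature.NumberTheory.EllipticCurves Literature.NumberTheory.EllipticCurves.ModularForms
  Literature.NumberTheory.EllipticCurves.Rank1Residual Literature.NumberTheory.IwasawaTheory
  Literature.NumberTheory.GaloisRepresentations
  Summit.BirchSwinnertonDyer.BirchSwinnertonDyer.Theses.CyclotomicUntwist
  Summit.BirchSwinnertonDyer.Rank1Residual.Additive

-- single-conjunct summit: `Summit.BirchSwinnertonDyer.BirchSwinnertonDyer.…` repeats the name by design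
set_option linter.dupNamespace false
set_option autoImplicit false

namespace Summit.BirchSwinnertonDyer.BirchSwinnertonDyer.Theorems.PSC1OfPrintFive

/-! ### §1 Carayol's level theorem from modularity (tree theorems, assembled in the route's binder shape) -/

/-- **The `hlev` binder of the route's C1 files is a theorem granted modularity**: for every level `N ≥ 1`,
`IsNewformOf.level_eq_conductorNorm (N := N)` (a newform of an elliptic `W` at level `N` has `N = N_W`) follows from
`nonempty_modularParametrizationData` — the parametrisation datum is a newform of `W` at level `N_W`
(`exists_isNewformOf_of_nonempty_modularParametrizationData`), and strong multiplicity one across levels on `Γ₀`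
pins every other level (`IsNewformOf.level_eq_conductorNorm_of_exists_isNewformOf'`).
[cite: AtkinLehner1970, Thm. 4] [cite: DiamondShurman2005, Thm. 8.8.1] [cite: BCDTJAMS2001, Thm. A] -/
theorem level_eq_conductorNorm_of_modularity (hmod : nonempty_modularParametrizationData) :
    ∀ (N : ℕ) [NeZero N], IsNewformOf.level_eq_conductorNorm (N := N) :=
  fun _ _ ↦ IsNewformOf.level_eq_conductorNorm_of_exists_isNewformOf'
    (exists_isNewformOf_of_nonempty_modularParametrizationData hmod)

/-- **One period ratio for every newform of `W`, from modularity alone**: for `W` globally minimal there is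
`ϖ ∈ ℚ`, `ϖ > 0`, with `ϖ·Ω_E = Ω⁺_f` for EVERY newform `f` of `W` at any level — cycu-p2's
`CyclotomicUntwistFiniteSlopeSeparatedPinnedExistence.exists_periodRatio` with its Carayol binder discharged by
`level_eq_conductorNorm_of_modularity`. [cite: BCDTJAMS2001, Thm. A] [cite: AtkinLehner1970, Thm. 4] -/
theorem exists_periodRatio_of_modularity (hmod : nonempty_modularParametrizationData)
    (W : WeierstrassCurve ℚ) [W.IsElliptic] [W.IsGloballyMinimal] :
    ∃ ϖ : ℚ, 0 < ϖ ∧ ∀ {N : ℕ} [NeZero N] (f : CuspForm (Gamma0 N) 2), IsNewformOf W f →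
      (ϖ : ℝ) * W.realPeriodRat = plusPeriod f :=
  CyclotomicUntwistFiniteSlopeSeparatedPinnedExistence.exists_periodRatio hmod
    (level_eq_conductorNorm_of_modularity hmod) W

/-! ### §2 C1 by name from five named print facts -/

/-- **C1 `PSUntwistedLFunctionAtThree` ⟸ FIVE named print facts, by name (CONDITIONAL result)**: modularity
(`nonempty_modularParametrizationData`), Gross–Zagier I.(7.3) (`GrossZagier1986_thm_I_7_3`), Gross–Zagier–Kolyvagin
(`PublishedInputGZK`, route item 19921), Deligne's `ℓ`-adic representations of `Γ₁`-newforms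
(`Hida2000_thm326_exists_galoisRep`) and Carayol 1986 Thm. (A) in Euler-factor form (`Carayol1986_eulerFactor`) —
the lead's six-fact closer `PSC1OfPrint.psUntwistedLFunctionAtThree_of_print` (p651954) with its Carayol-LEVEL
binder supplied by `level_eq_conductorNorm_of_modularity`. [cite: CarayolASENS1986, Thm. (A)]
[cite: Hida2000, Thm. 3.26 (1)] [cite: GrossZagier1986, Thm. I.(7.3)] [cite: MazurTateTeitelbaum1986Invent, §I.14]
[cite: AtkinLehner1970, Thm. 4] -/
theorem psUntwistedLFunctionAtThree_of_print5
    (hmod : nonempty_modularParametrizationData)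
    (hGZ86 : GrossZagier1986_thm_I_7_3) (hGZK : PublishedInputGZK)
    (hD : Hida2000_thm326_exists_galoisRep) (hC : Carayol1986_eulerFactor) :
    PSUntwistedLFunctionAtThree :=
  PSC1OfPrint.psUntwistedLFunctionAtThree_of_print hmod (level_eq_conductorNorm_of_modularity hmod)
    hGZ86 hGZK hD hC

/-- **The registered print stub `stub_PRINT_C1` of the K1/K2 skeletons (v7, five conjuncts, text verbatim) from
FOUR named print facts** — the Carayol-level conjunct is `level_eq_conductorNorm_of_modularity`.
[cite: AtkinLehner1970, Thm. 4] [cite: BCDTJAMS2001, Thm. A] [cite: CarayolASENS1986, Thm. (A)]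
[cite: Hida2000, Thm. 3.26 (1)] [cite: GrossZagier1986, Thm. I.(7.3)] -/
theorem stub_PRINT_C1_of_four
    (hmod : nonempty_modularParametrizationData) (hGZ86 : GrossZagier1986_thm_I_7_3)
    (hD : Hida2000_thm326_exists_galoisRep) (hC : Carayol1986_eulerFactor) :
    nonempty_modularParametrizationData ∧
      (∀ (N : ℕ) [NeZero N], IsNewformOf.level_eq_conductorNorm (N := N)) ∧
      GrossZagier1986_thm_I_7_3 ∧ Hida2000_thm326_exists_galoisRep ∧ Carayol1986_eulerFactor :=
  ⟨hmod, level_eq_conductorNorm_of_modularity hmod, hGZ86, hD, hC⟩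

/-! ### §3 Variant over primary Gross–Zagier facts -/

/-- **C1 by name with `GrossZagier1986_thm_I_7_3` replaced by its sources**: modularity, Hoffstein–Luo 1997
(`HoffsteinLuo1997_exists_twist_L_one_ne_zero`, the non-vanishing quadratic twist with an odd Heegner
discriminant) and the Gross–Zagier formula over the Heegner field (`gross_zagier`, GZ86 Thm. V.(2.1)) give
GZ86 I.(7.3) by the tree's `GrossZagier1986_thm_I_7_3_of_hoffsteinLuo`; whence C1 from
{hmod, Hoffstein–Luo, `gross_zagier`, GZK, hDel, hCar}. CONDITIONAL result; nothing asserted.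
[cite: GrossZagier1986, Thm. I.(7.3) and Thm. V.(2.1)] [cite: HoffsteinLuo1997] [cite: CarayolASENS1986, Thm. (A)]
[cite: Hida2000, Thm. 3.26 (1)] -/
theorem psUntwistedLFunctionAtThree_of_primaryPrint
    (hmod : nonempty_modularParametrizationData)
    (hHL : HoffsteinLuo1997_exists_twist_L_one_ne_zero)
    (hGZ : ∀ (N : ℕ) [NeZero N] (W : WeierstrassCurve ℚ) (K : Type) [Field K] [NumberField K],
      gross_zagier N W K)
    (hGZK : PublishedInputGZK)
    (hD : Hida2000_thm326_exists_galoisRep) (hC : Carayol1986_eulerFactor) :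
    PSUntwistedLFunctionAtThree :=
  psUntwistedLFunctionAtThree_of_print5 hmod (GrossZagier1986_thm_I_7_3_of_hoffsteinLuo hmod hHL hGZ) hGZK hD hC

end Summit.BirchSwinnertonDyer.BirchSwinnertonDyer.Theorems.PSC1OfPrintFive

end
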